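/-
Copyright (c) 2026 the pub-hodgecm-mathlib formalisation cell (harness21).  Prover seat hodgecm-mathlib-K2E4-p14 (g2), Track B «K2-LIT» ∕ h413,
ENGINE E3 unit U4 «Keys», row #6 `sig_K2E3IrregularReducibleCaseThree` — the UNRAMIFIED rung of the analytic letter hJ (dealer K2E3-plan (g1) 2026-09-03T23:40:43Z (d)).
-/
import Mathlib
import HarnessLib

/-!
# K2 · E3 · U4 «Keys», row #6: the UNRAMIFIED RUNG of Keys' Plancherel non-vanishing — `∫_{E¹} (−1)^{val_E(1+u)} du = (q²+1)∕(q+1)² · vol(E¹) > 0`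
# (Keys 1984 §5 (Plancherel measure of the unitary principal series), §7 Thm. (1); Rogawski 1990 §12.2 (3))

Cell `pub/hodgecm-mathlib` (D-0151), HCML Track B, crux H413 = `stmt-HodgeConjecture-24833`; socket `sig_K2E3IrregularReducibleCaseThree` (U4-c) of
`Cruxes/H413/Lines/K2_E3_EllipticInputsSigs_U4Keys.lean`, ★-reduced by K2E3-p06 (g0) (★ p855287 · p855368 · p855448 · p855477) to ONE analytic letter hJ:
«`J(χ₁) = ∫_{E⁻} ‖1+η‖_E⁻¹ χ₁(σ(1+η))⁻¹ dη ≠ 0` for continuous `χ₁` with `χ₁|_{N E^×} = 1`, `χ₁|_{F^×} ≠ 1`» (`E = L_w ⊃ F = L⁺_v`, `v` non-split; line lead K2E3-p06 (g2),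
Tate road F1–F7).  THIS FILE is the dealer's CASE II rung (K2E4-p14 (g2) REPORT `K2/K2E4-p14/g2/REPORT-U4c-hJ.K2E4-p14-g2.md` §2): when `χ₁` is UNRAMIFIED the two
constraints force `v` inert and `χ₁ = (−1)^{val_E}`, and after the Cayley disintegration `J = χ₁(2)·vol·∫_{E¹} χ₁(1+u) du` (REPORT §1) the letter is the finite identity
  `∫_{E¹} (−1)^{val_E(1+u)} du = (1 − 1∕(q+1)) + Σ_{k ≥ 1} (−1)^k (q−1)∕((q+1) q^k) · vol = (q²+1)∕(q+1)² · vol(E¹) > 0`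
over the compact group `E¹ = {u ∈ E : u ū = 1}` with its filtration `E¹_k = E¹ ∩ (1 + 𝔭_E^k)` (`[E¹ : E¹_1] = q+1`, `[E¹_k : E¹_{k+1}] = q`: kernels of the residual norm and
trace), UNIFORMLY in the residue characteristic (dyadic places included): the strata `{val_E(1+u) = k} = (−E¹_k) ∖ (−E¹_{k+1})` (`k ≥ 1`), `{val_E(1+u) = 0} = E¹ ∖ (−E¹_1)`.

WHAT IS PROVED (group-theoretic core, Mathlib only; the two index facts enter as HYPOTHESES — they are standard local algebra (Hensel) and are the rung's remaining
sub-letters):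
* §1 `measure_univ_eq_index_mul` — for a left-invariant measure and a measurable finite-index subgroup `H`: `μ(G) = [G:H] · μ(H)` (coset decomposition);
  `measure_smul_subgroup` — `μ(c·H) = μ(H)`.
* §2 `tsum_strata_eq` — the series `Σ_{k≥0} (−1)^k (a_k − a_{k+1})` with `a_0 = M`, `a_k = M∕((q+1)q^{k−1})` equals `M·(q²+1)∕(q+1)²`.
* §3 **`integral_negOnePow_strata_eq`** — for a finite left-invariant measure `μ` on a group `G`, a descending chain of measurable subgroups `A 0 = ⊤ ≥ A 1 ≥ …` with
  `[G : A k] = (q+1)·q^{k−1}` (`k ≥ 1`, `2 ≤ q`), an element `c` (the rôle of `−1`) and any measurable `h` with `|h| ≤ 1` and `h = (−1)^k` on `c·A_k ∖ c·A_{k+1}`: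
  `∫ h dμ = μ(G)·(q²+1)∕(q+1)²`; **`integral_negOnePow_strata_pos`** — hence `0 < ∫ h dμ` when `μ ≠ 0`.
The instantiation `G = E¹ ⊂ (L_w)^×`, `A k = E¹ ∩ (1+𝔭_w^k)`, `c = −1`, `h u = (−1)^{val_w(1+u)}` is literal (`val_w(1+u) = k ⟺ u ∈ (−E¹_k) ∖ (−E¹_{k+1})`); the index
hypotheses are [Serre, Corps locaux, V §2 Prop. 2–3 ∕ XIII §4] for the unramified quadratic `L_w ∕ L⁺_v`.  THEOREMS ONLY (no `def`, no `instance`, no notation, no `sorry`);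
lane `--supports stmt-HodgeConjecture-24833 --as helper`.
HONEST LABEL: HC_CM is proved only modulo the 7 printed citations (2 remaining named inputs: hLiu418 = stmt-HodgeConjecture-24832, h413 = stmt-HodgeConjecture-24833) until rung 0
closes; count-neutral rung — it pays no socket (hJ is the line lead's; this is its unramified case modulo the two filtration indices and the Cayley bridge).

## References
* [Keys1984] D. Keys, *Principal series representations of special unitary groups over local fields*, Compositio Math. 51 (1984), §5; §7 Thm. (1) p. 126.
* [Rogawski1990] J. D. Rogawski, *Automorphic Representations of Unitary Groups in Three Variables*, Ann. of Math. Stud. 123 (1990), §12.2 (3) pp. 173–174.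
* [Serre1979] J.-P. Serre, *Local Fields*, GTM 67 (1979), Ch. V §2, Ch. XIII §4 (filtration of the norm-one torus).
-/

set_option autoImplicit false
-- the mandated namespace repeats the single-problem summit's segment (`HodgeConjecture.HodgeConjecture`)
set_option linter.dupNamespace false

noncomputable section

open MeasureTheory Set Filter Topology
open scoped ENNReal NNReal

namespace Summit.HodgeConjecture.HodgeConjecture.Cruxes.H413.K2E3KeysPlancherelNonvanishingUnramified

/-! ## §1 Left-invariant measures and finite-index subgroups -/

section Index

variable {G : Type*} [Group G] [MeasurableSpace G] [MeasurableMul G] (μ : Measure G) [μ.IsMulLeftInvariant]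

/-- A left translate of a set has the same measure. [cite: Serre1979, Ch. XIII §4] -/
theorem measure_smul_eq (c : G) (s : Set G) : μ ((fun x => c * x) '' s) = μ s := by
  have h : (fun x => c * x) '' s = (fun x => c⁻¹ * x) ⁻¹' s := by
    ext x
    simp only [mem_image, mem_preimage]
    constructor
    · rintro ⟨y, hy, rfl⟩
      simpa [inv_mul_cancel_left] using hy
    · intro hx
      exact ⟨c⁻¹ * x, hx, by simp [mul_inv_cancel_left]⟩
  rw [h, measure_preimage_mul]

/-- **Coset decomposition**: for a left-invariant measure and a measurable subgroup `H` of finite index, `μ(G) = [G : H] · μ(H)`.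
[cite: Serre1979, Ch. XIII §4] -/
theorem measure_univ_eq_index_mul (H : Subgroup G) (hH : MeasurableSet (H : Set G)) [H.FiniteIndex] :
    μ univ = H.index * μ H := by
  classical
  haveI : Finite (G ⧸ H) := Subgroup.finite_quotient_of_finiteIndex
  haveI : Fintype (G ⧸ H) := Fintype.ofFinite _
  -- the fibres of `G → G ⧸ H`
  have hfib : ∀ q : G ⧸ H, (QuotientGroup.mk : G → G ⧸ H) ⁻¹' {q} = (fun x => (Quotient.out q)⁻¹ * x) ⁻¹' (H : Set G) := by
    intro q
    ext x
    simp only [mem_preimage, mem_singleton_iff, SetLike.mem_coe]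
    rw [← QuotientGroup.eq, QuotientGroup.out_eq']
    exact eq_comm
  have hcover : (univ : Set G) = ⋃ q : G ⧸ H, (QuotientGroup.mk : G → G ⧸ H) ⁻¹' {q} := by
    ext x
    simp only [mem_univ, mem_iUnion, mem_preimage, mem_singleton_iff, exists_eq']
  have hdisj : Pairwise (Function.onFun Disjoint fun q : G ⧸ H => (QuotientGroup.mk : G → G ⧸ H) ⁻¹' {q}) := by
    intro q q' hqq'
    exact Disjoint.preimage _ (disjoint_singleton.2 hqq')
  have hmeas : ∀ q : G ⧸ H, MeasurableSet ((QuotientGroup.mk : G → G ⧸ H) ⁻¹' {q}) := by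
    intro q
    rw [hfib q]
    exact measurable_const_mul _ hH
  rw [hcover, measure_iUnion hdisj hmeas, tsum_fintype]
  have hq : ∀ q : G ⧸ H, μ ((QuotientGroup.mk : G → G ⧸ H) ⁻¹' {q}) = μ H := by
    intro q
    rw [hfib q, measure_preimage_mul]
  simp only [hq, Finset.sum_const, Finset.card_univ, nsmul_eq_mul]
  rw [Subgroup.index, Nat.card_eq_fintype_card]

/-- `μ(H) = μ(G) ∕ [G : H]` for a finite left-invariant measure and a measurable finite-index subgroup (real form). [cite: Serre1979, Ch. XIII §4] -/
theorem measureReal_subgroup_eq_div (H : Subgroup G) (hH : MeasurableSet (H : Set G)) [H.FiniteIndex] [IsFiniteMeasure μ] :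
    (μ H).toReal = (μ univ).toReal / H.index := by
  have hidx : (H.index : ℝ) ≠ 0 := Nat.cast_ne_zero.2 Subgroup.FiniteIndex.index_ne_zero
  rw [eq_div_iff hidx, measure_univ_eq_index_mul μ H hH, ENNReal.toReal_mul, ENNReal.toReal_natCast, mul_comm]

end Index

/-! ## §2 The series -/

/-- The alternating series of the strata: with `a 0 = M` and `a k = M ∕ ((q+1)·q^{k-1})` (`k ≥ 1`), `Σ_{k≥0} (−1)^k (a k − a (k+1)) = M·(q²+1)∕(q+1)²` (`2 ≤ q`).
[cite: Keys1984, §5] -/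
theorem hasSum_strata (q : ℕ) (hq : 2 ≤ q) (M : ℝ) (a : ℕ → ℝ) (ha0 : a 0 = M)
    (ha : ∀ k, a (k + 1) = M / (((q : ℝ) + 1) * (q : ℝ) ^ k)) :
    HasSum (fun k => (-1 : ℝ) ^ k * (a k - a (k + 1))) (M * (((q : ℝ) ^ 2 + 1) / ((q : ℝ) + 1) ^ 2)) := by
  have hq0 : (0 : ℝ) < q := by exact_mod_cast (by omega : 0 < q)
  have hq1 : (q : ℝ) + 1 ≠ 0 := by positivity
  -- the geometric series `Σ_k (−1)^(k+1) · a (k+1) = −(M/(q+1)) · Σ_k (−1/q)^k = −M q/(q+1)²`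
  have hr : ‖(-(q : ℝ)⁻¹)‖ < 1 := by
    rw [norm_neg, norm_inv, Real.norm_natCast]
    exact inv_lt_one_of_one_lt₀ (by exact_mod_cast (by omega : 1 < q))
  have hgeo := hasSum_geometric_of_norm_lt_one hr
  have htail : HasSum (fun k => (-1 : ℝ) ^ (k + 1) * a (k + 1)) (-(M * q / ((q : ℝ) + 1) ^ 2)) := by
    have h1 : ∀ k, (-1 : ℝ) ^ (k + 1) * a (k + 1) = -(M / ((q : ℝ) + 1)) * (-(q : ℝ)⁻¹) ^ k := by
      intro k
      rw [ha k, show (-(q : ℝ)⁻¹) = (-1 : ℝ) * (q : ℝ)⁻¹ by ring, mul_pow, inv_pow, pow_succ]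
      field_simp
    have h2 : -(M * q / ((q : ℝ) + 1) ^ 2) = -(M / ((q : ℝ) + 1)) * (1 - -(q : ℝ)⁻¹)⁻¹ := by
      field_simp
      ring
    rw [show (fun k => (-1 : ℝ) ^ (k + 1) * a (k + 1)) = fun k => -(M / ((q : ℝ) + 1)) * (-(q : ℝ)⁻¹) ^ k from funext h1, h2]
    exact hgeo.mul_left _
  -- `Σ_k (−1)^k a k = M − M q/(q+1)²` (shift by one)
  have hS : HasSum (fun k => (-1 : ℝ) ^ k * a k) (M + -(M * q / ((q : ℝ) + 1) ^ 2)) := by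
    refine (hasSum_nat_add_iff' (f := fun k => (-1 : ℝ) ^ k * a k) 1).mp ?_
    have hsum1 : (∑ i ∈ Finset.range 1, (-1 : ℝ) ^ i * a i) = M := by
      rw [Finset.sum_range_one, pow_zero, one_mul, ha0]
    rw [hsum1, show M + -(M * q / ((q : ℝ) + 1) ^ 2) - M = -(M * q / ((q : ℝ) + 1) ^ 2) by ring]
    exact htail
  -- the difference
  have hdiff : HasSum (fun k => (-1 : ℝ) ^ k * (a k - a (k + 1)))
      ((M + -(M * q / ((q : ℝ) + 1) ^ 2)) + -(M * q / ((q : ℝ) + 1) ^ 2)) := by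
    have h3 : ∀ k, (-1 : ℝ) ^ k * (a k - a (k + 1)) = (-1 : ℝ) ^ k * a k + (-1 : ℝ) ^ (k + 1) * a (k + 1) := by
      intro k; rw [pow_succ]; ring
    rw [show (fun k => (-1 : ℝ) ^ k * (a k - a (k + 1))) = fun k => (-1 : ℝ) ^ k * a k + (-1 : ℝ) ^ (k + 1) * a (k + 1) from funext h3]
    exact hS.add htail
  convert hdiff using 1
  field_simp
  ring

/-! ## §3 The strata integral on a group with a descending chain of finite-index subgroups -/

section Strata

variable {G : Type*} [Group G] [MeasurableSpace G] [MeasurableMul G] (μ : Measure G) [μ.IsMulLeftInvariant] [IsFiniteMeasure μ]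

/-- **THE UNRAMIFIED RUNG (group-theoretic core).**  Let `μ` be a finite left-invariant measure on a group `G`, `A : ℕ → Subgroup G` a descending chain of measurable
subgroups with `A 0 = ⊤` and `[G : A k] = (q+1)·q^(k−1)` for `k ≥ 1` (`2 ≤ q`), `c ∈ G`, and `h : G → ℝ` measurable with `|h| ≤ 1` and `h = (−1)^k` on the stratum
`c·(A k ∖ A (k+1))`.  Then `∫ h dμ = μ(G)·(q²+1)∕(q+1)²`.  (For `G = E¹ ⊂ E^×`, `A k = E¹ ∩ (1+𝔭_E^k)`, `c = −1`, `h = (−1)^{val_E(1+·)}` this is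
`∫_{E¹}(−1)^{val_E(1+u)}du = (q²+1)∕(q+1)²·vol`, the unramified case of Keys' Plancherel non-vanishing at a `w`-fixed unitary character.)
[cite: Keys1984, §5; §7 Thm. (1) p. 126] [cite: Rogawski1990, §12.2 (3) pp. 173–174] [cite: Serre1979, Ch. V §2] -/
theorem integral_negOnePow_strata_eq (q : ℕ) (hq : 2 ≤ q) (A : ℕ → Subgroup G) (hmeas : ∀ k, MeasurableSet (A k : Set G))
    (hA0 : A 0 = ⊤) (hanti : ∀ k, A (k + 1) ≤ A k) (hidx : ∀ k, (A (k + 1)).index = (q + 1) * q ^ k)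
    (c : G) (h : G → ℝ) (hh_meas : Measurable h) (hbd : ∀ u, |h u| ≤ 1)
    (hh : ∀ (k : ℕ) (u : G), c⁻¹ * u ∈ A k → c⁻¹ * u ∉ A (k + 1) → h u = (-1 : ℝ) ^ k) :
    ∫ u, h u ∂μ = (μ univ).toReal * (((q : ℝ) ^ 2 + 1) / ((q : ℝ) + 1) ^ 2) := by
  classical
  have hq0 : (0 : ℝ) < q := by exact_mod_cast (by omega : 0 < q)
  -- finite index of every `A (k+1)`
  have hfi : ∀ k, (A (k + 1)).FiniteIndex := fun k => ⟨by rw [hidx k]; positivity⟩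
  -- the translated chain `B k = c·(A k)` and the strata `S k = B k ∖ B (k+1)`
  set B : ℕ → Set G := fun k => (fun x => c⁻¹ * x) ⁻¹' (A k : Set G) with hB
  have hBmeas : ∀ k, MeasurableSet (B k) := fun k => measurable_const_mul _ (hmeas k)
  have hBanti : ∀ k, B (k + 1) ⊆ B k := fun k x hx => hanti k hx
  have hB0 : B 0 = univ := by
    ext x; simp [hB, hA0]
  have hμB : ∀ k, μ (B k) = μ (A k) := fun k => measure_preimage_mul μ c⁻¹ _
  -- real measures of the chain
  set a : ℕ → ℝ := fun k => (μ (B k)).toReal with ha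
  have ha0 : a 0 = (μ univ).toReal := by simp only [ha, hB0]
  have haS : ∀ k, a (k + 1) = (μ univ).toReal / (((q : ℝ) + 1) * (q : ℝ) ^ k) := by
    intro k
    haveI := hfi k
    simp only [ha, hμB]
    rw [measureReal_subgroup_eq_div μ (A (k + 1)) (hmeas (k + 1)), hidx k]
    push_cast
    ring
  set S : ℕ → Set G := fun k => B k \ B (k + 1) with hS
  have hSmeas : ∀ k, MeasurableSet (S k) := fun k => (hBmeas k).diff (hBmeas (k + 1))
  -- the strata are pairwise disjoint
  have hBmono : ∀ {j k}, j ≤ k → B k ⊆ B j := by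
    intro j k hjk
    induction hjk with
    | refl => exact Subset.rfl
    | step _ ih => exact (hBanti _).trans ih
  have hSdisj : Pairwise (Function.onFun Disjoint S) := by
    intro j k hjk
    rcases lt_or_gt_of_ne hjk with hlt | hlt
    · exact disjoint_left.2 fun x hxj hxk => hxj.2 (hBmono (Nat.succ_le_of_lt hlt) hxk.1)
    · exact disjoint_left.2 fun x hxj hxk => hxk.2 (hBmono (Nat.succ_le_of_lt hlt) hxj.1)
  -- their union has full measure: the complement is `⋂ B k`, of measure `≤ μ(B k) → 0`
  have hcompl : univ \ (⋃ k, S k) ⊆ ⋂ k, B k := by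
    intro x hx
    simp only [Set.mem_sdiff, mem_univ, mem_iUnion, true_and, not_exists] at hx
    rw [mem_iInter]
    intro k
    induction k with
    | zero => rw [hB0]; exact mem_univ _
    | succ k ih =>
      by_contra hxk
      exact hx k ⟨ih, hxk⟩
  have hμInter : μ (⋂ k, B k) = 0 := by
    -- `μ(⋂ B) ≤ μ(B (k+1)) = μ(G)/((q+1) q^k)` for every `k`
    have hle : ∀ k, (μ (⋂ k, B k)).toReal ≤ (μ univ).toReal / (((q : ℝ) + 1) * (q : ℝ) ^ k) := by
      intro k
      rw [← haS k]
      exact ENNReal.toReal_mono (measure_ne_top μ _) (measure_mono (iInter_subset _ (k + 1)))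
    have hlim : Tendsto (fun k : ℕ => (μ univ).toReal / (((q : ℝ) + 1) * (q : ℝ) ^ k)) atTop (𝓝 0) := by
      have h1 : Tendsto (fun k : ℕ => ((q : ℝ)⁻¹) ^ k) atTop (𝓝 0) :=
        tendsto_pow_atTop_nhds_zero_of_lt_one (inv_nonneg.2 hq0.le) (inv_lt_one_of_one_lt₀ (by exact_mod_cast (by omega : 1 < q)))
      have h2 : (fun k : ℕ => (μ univ).toReal / (((q : ℝ) + 1) * (q : ℝ) ^ k)) = fun k => (μ univ).toReal / ((q : ℝ) + 1) * ((q : ℝ)⁻¹) ^ k := by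
        funext k; rw [inv_pow]; field_simp
      rw [h2]
      simpa using h1.const_mul ((μ univ).toReal / ((q : ℝ) + 1))
    have h0 : (μ (⋂ k, B k)).toReal ≤ 0 := ge_of_tendsto' hlim hle
    have h0' : (μ (⋂ k, B k)).toReal = 0 := le_antisymm h0 ENNReal.toReal_nonneg
    exact (ENNReal.toReal_eq_zero_iff _).1 h0' |>.resolve_right (measure_ne_top μ _)
  have hfull : μ (univ \ ⋃ k, S k) = 0 := measure_mono_null hcompl hμInter
  -- `h` on a stratum
  have hhS : ∀ k, ∀ u ∈ S k, h u = (-1 : ℝ) ^ k := fun k u hu => hh k u hu.1 hu.2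
  have hint : Integrable h μ := by
    refine Integrable.of_bound hh_meas.aestronglyMeasurable 1 (Filter.Eventually.of_forall fun u => ?_)
    rw [Real.norm_eq_abs]; exact hbd u
  -- the integral over the union of the strata
  have hae : (⋃ k, S k) =ᵐ[μ] (univ : Set G) := by
    rw [ae_eq_univ, Set.compl_eq_univ_sdiff]
    exact hfull
  have hI : ∫ u, h u ∂μ = ∑' k, ∫ u in S k, h u ∂μ := by
    rw [← setIntegral_univ, ← setIntegral_congr_set hae]
    exact integral_iUnion hSmeas hSdisj hint.integrableOn
  -- each stratum contributes `(−1)^k · (a k − a (k+1))`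
  have hSk : ∀ k, ∫ u in S k, h u ∂μ = (-1 : ℝ) ^ k * (a k - a (k + 1)) := by
    intro k
    rw [setIntegral_congr_fun (hSmeas k) (fun u hu => hhS k u hu), setIntegral_const, smul_eq_mul, mul_comm]
    congr 1
    simp only [ha, hS, measureReal_def]
    rw [measure_sdiff (hBanti k) (hBmeas (k + 1)).nullMeasurableSet (measure_ne_top μ _),
      ENNReal.toReal_sub_of_le (measure_mono (hBanti k)) (measure_ne_top μ _)]
  rw [hI, tsum_congr hSk]
  exact (hasSum_strata q hq (μ univ).toReal a ha0 haS).tsum_eq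

/-- **Positivity of the unramified rung**: under the hypotheses of `integral_negOnePow_strata_eq` and `μ ≠ 0`, `0 < ∫ h dμ` — Keys' «`μ(λ) ≠ 0`» for the unramified
`w`-fixed character `λ = (−1)^{val_E}` of `E^×` (the case `λ|_{F^×} = ω_{E∕F}` with `λ` unramified). [cite: Keys1984, §5; §7 Thm. (1) p. 126] [cite: Rogawski1990, §12.2 (3) p. 173] -/
theorem integral_negOnePow_strata_pos (q : ℕ) (hq : 2 ≤ q) (A : ℕ → Subgroup G) (hmeas : ∀ k, MeasurableSet (A k : Set G))
    (hA0 : A 0 = ⊤) (hanti : ∀ k, A (k + 1) ≤ A k) (hidx : ∀ k, (A (k + 1)).index = (q + 1) * q ^ k)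
    (c : G) (h : G → ℝ) (hh_meas : Measurable h) (hbd : ∀ u, |h u| ≤ 1)
    (hh : ∀ (k : ℕ) (u : G), c⁻¹ * u ∈ A k → c⁻¹ * u ∉ A (k + 1) → h u = (-1 : ℝ) ^ k) (hμ : μ ≠ 0) :
    0 < ∫ u, h u ∂μ := by
  rw [integral_negOnePow_strata_eq μ q hq A hmeas hA0 hanti hidx c h hh_meas hbd hh]
  have hM : 0 < (μ univ).toReal := ENNReal.toReal_pos (Measure.measure_univ_ne_zero.2 hμ) (measure_ne_top μ _)
  positivity

end Strata

end Summit.HodgeConjecture.HodgeConjecture.Cruxes.H413.K2E3KeysPlancherelNonvanishingUnramified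

end
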